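import Mathlib.Data.Finsupp.Fin
import Literature.NumberTheory.Transcendental.PhilipponCriterionCh8
import Literature.NumberTheory.Transcendental.DiazZeroLemmaProofs
import HarnessLib

/-!
# Diaz 1989, Théorème 1, from Philippon's criterion in the form of LNM 1752 Ch. 8 Corollary 1.1

Topic `Literature/NumberTheory/Transcendental`. Proofs (plus one auxiliary definition, the
coefficientwise homogenisation `Ch8Transfer.homog`) re-deriving the tree's named fact
`Literature.NumberTheory.Transcendental.Diaz1989_thm1` (`DiazMain.lean`; G. Diaz, J. Number
Theory 31 (1989), Théorème 1: `trdeg_ℚ ℚ(v_k, e^{u_hv_k}) ≥ [(mn+m)/(m+n)]` under (HT1)) from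

* `NesterenkoPhilippon2001_ch8_cor_1_1` (`PhilipponCriterionCh8.lean`: Philippon's criterion for
  algebraic independence in the form of Nesterenko–Philippon (eds.), LNM 1752, Ch. 8, §1,
  Corollary 1.1 — a family of forms without common zero in a small projective ball), and
* `Diaz1989_zeroLemma` (`DiazZeroLemma.lean`; itself PROVED from Philippon's zero estimate
  `Philippon1986_GaGm_P1n` in `DiazZeroLemmaProofs.lean`),

in place of the *critère principal* `Philippon1986_mainCriterion` (Philippon 1986, Thm 2.11) used
by `Diaz1989_thm1_of_criterion` (`DiazThm1Proofs.lean`). Everything upstream of the criterion is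
the tree's proved construction (`DiazConstruction` … `DiazThm1Proofs`: at every large
`X_N = N + N₁` the family `𝓕_N` of the `Q_{μj}` is small at `θ = (v_k, e^{u_hv_k})`, has degrees
and logarithmic lengths `≤ c_δΦ₀(X_N)`, and NO common zero in the polydisc
`max|zᵢ − θᵢ| ≤ e^{−ρ(X_N)}`, `GoodX.small_famPoly/degLen_famPoly/exists_ne_zero`). Main results:

* `le_trdeg_of_eventually_goodX_ch8` — the exponent-free core: Ch. 8 Cor. 1.1 and "all large `X`
  are good" (`DiazThm1.GoodX`, i.e. (HT1) already consumed by `DiazThm1.eventually_goodX`) give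
  `trdeg_ℚ ℚ(v_k, e^{u_hv_k}) ≥ [(mn+m)/(m+n)]`; reused with other measures in `DiazMainProofs.lean`;
* `Diaz1989_thm1_of_ch8 : NesterenkoPhilippon2001_ch8_cor_1_1 → Diaz1989_zeroLemma → Diaz1989_thm1`
  (the core with Diaz's exponents `η_a = m(n+1)/(2m+n)`, `η_b = m(n+1)/(m+2n+1)`);
* `Diaz1989_thm1_of_ch8_P1n : NesterenkoPhilippon2001_ch8_cor_1_1 → Philippon1986_GaGm_P1n →
  Diaz1989_thm1`, and the same for `diaz_1989` (the Gelfond–Diaz ladder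
  `trdeg ℚ(α^β, …, α^{β^{d-1}}) ≥ [(d+1)/2]`), `Diaz1989_gridX` (LNM 1752 Ch. 14 Thm 2.7, clause
  `t₁`) and `Diaz1989_cor1`.

So the trust base of these four facts may now be taken to be {LNM 1752 Ch. 8 Cor. 1.1 (two printed
pages from the five Ch. 6 statements: closest point property, geometric/arithmetic/first and
second metric Bézout theorems), Philippon's zero estimate on `𝔾ₐ × 𝔾ₘⁿ`}.

## The transfer (what is proved here, and where it deviates from `Diaz1989_thm1_of_criterion`)

Corollary 1.1 is projective: a point `x ∈ ℙ_q(ℂ)` with `x₀ ≠ 0`, FORMS `Q ∈ ℤ[X₀, …, X_q]`, the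
height `h₁(Q) = log ‖Q‖` (`Philippon.formLogHeight`, `‖Q‖² = ∑ |Q_α|²/binom(|α|, α)`), the value
`|Q(x)| / (‖Q‖ ‖x‖^{d°Q})`, balls for the sine distance `Dist` on `ℙ_q(ℂ)` (`Philippon.sineDist`).
Diaz's data are affine: `θ ∈ ℂ^q` (`q = m + nm`), polynomials `Q ∈ ℤ[X₁, …, X_q]` with
`deg Q, log L(Q) ≤ c_δΦ₀`, `|Q(θ)| ≤ e^{−c_SΨ₀}`, no common zero in a polydisc. The dictionary:

* `x = (1 : θ)`, `ʰQ = homog Q` (`X^β ↦ X₀^{deg Q − |β|}X^β`): `ʰQ` is a form of degree `deg Q`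
  (`isHomogeneous_homog`, `totalDegree_homog`), `ʰQ(1, z) = Q(z)` (`aeval_homog_cons_one`), same
  multiset of coefficients (`sum_abs_coeff_homog`), hence `‖ʰQ‖ ≤ ∑|Q_α| = L(Q)`
  (`formNorm_le_sum_abs_coeff`) and `h₁(ʰQ) ≤ log L(Q) ≤ c_δΦ₀`;
* a non-zero integer form of degree `d` in `q + 1` letters has `‖ʰQ‖² ≥ (q+1)^{−d}`
  (`inv_pow_le_formNorm_sq`, via `binom(|α|, α) ≤ (q+1)^{|α|}`, `multinomial_le_pow`), so
  `|ʰQ(x)|/(‖ʰQ‖ ‖x‖^d) ≤ e^{−c_SΨ₀}(q+1)^{d/2} ≤ e^{−c_SΨ₀/2}` once `c_δΦ₀ log(q+1) ≤ c_SΨ₀/2`;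
* forms scale, `ʰQ(cy) = c^dʰQ(y)` (`aeval_smul_of_isHomogeneous`), and the projective ball
  `Dist(x, y) ≤ r` with `2r‖x‖ ≤ 1` lies in the chart `y₀ ≠ 0` inside the polydisc
  `max|yᵢ/y₀ − θᵢ| ≤ 2r‖x‖²` (`polydisc_of_sineDist_le`, from `∑ⱼ|x₀yⱼ − xⱼy₀|² ≤ ‖x ∧ y‖²`,
  `sum_row_zero_le_wedgeNormSq`); with `r = e^{−U(j−1)σ₀}`, `U = c_SΨ₀/2`, `ρ = 16(n+1)Ψ₀` and
  `Ψ₀(X+1) ≤ 2^{m(n+1)+1}Ψ₀(X)` a constant `σ₀ = σ₀(n, m, ‖x‖, c_S)` makes `2r‖x‖² ≤ e^{−ρ(X_j)}`,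
  so a common zero of the `ʰQ` in the ball would give a common zero of the `Q` in Diaz's polydisc;
* growth functions: `δ(j) = c_δΦ₀(X_j)`, `τ(j) = δ(j) + σ₀^{k+1} + 1`, `σ ≡ σ₀`,
  `U(j) = c_SΨ₀(X_j)/2`, `k + 1 = [(mn+m)/(m+n)]`; they are `≥ 1`, non-decreasing, `τ ≥ δ`,
  `σ^{k+1} < τ < U` (the last for `X_j` beyond a threshold absorbed into `N₁`), `τ → ∞`, and
  `U/(τδᵏσ^{k+1}) ≥ Ψ₀/(BΦ₀^{k+1}) → ∞` by the tree's `eventually_Phi0_pow_le_Psi0`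
  (`(m+n)(k+1) ≤ m(n+1)`, and `(k+1)/(n+1) < 1` in case of equality).

Everything in this file is proved; `#print axioms Diaz1989_thm1_of_ch8` is
`{propext, Classical.choice, Quot.sound}`.

## References

* G. Diaz, *Grands degrés de transcendance pour des familles d'exponentielles*, J. Number Theory
  31 (1989), 1–23, Théorème 1 (pp. 1–2), §II-4-3 (p. 16).
* Yu. V. Nesterenko, P. Philippon (eds.), *Introduction to Algebraic Independence Theory*,
  LNM 1752, Springer 2001, Ch. 8 §1 Corollary 1.1 (PDF pp. 165–166); Ch. 6 §5 (pp. 112–113);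
  Ch. 14 Thm 2.7, Cor. 2.8 (p. 248).
* R. Hartshorne, *Algebraic Geometry*, GTM 52, I §2, proof of Prop. 2.2 (homogenisation `β`).
-/

noncomputable section

open MvPolynomial Filter Finset

namespace Literature.NumberTheory.Transcendental

namespace Ch8Transfer

open Philippon

open Finsupp in
/-! ### Homogenisation of an affine integer polynomial -/

variable {q : ℕ}

/-- The homogenisation `ʰg(X₀, …, X_q) = X₀^{deg g} g(X₁/X₀, …, X_q/X₀)` of `g ∈ ℤ[X₁, …, X_q]`,
written coefficientwise: the monomial `X^β` of `g` becomes `X₀^{deg g - |β|} X^β`. [folklore] -/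
def homog (g : MvPolynomial (Fin q) ℤ) : MvPolynomial (Fin (q + 1)) ℤ :=
  ∑ β ∈ g.support, monomial (Finsupp.cons (g.totalDegree - β.degree) β) (g.coeff β)

/-- The exponent map `β ↦ (deg g - |β|, β)` is injective. [folklore] -/
theorem cons_sub_injective (d : ℕ) :
    Function.Injective fun β : Fin q →₀ ℕ => Finsupp.cons (d - β.degree) β := by
  intro β β' h
  have := congrArg Finsupp.tail h
  simpa [Finsupp.tail_cons] using this

/-- The coefficient of `X₀^{deg g - |β|} X^β` in `ʰg` is the coefficient of `X^β` in `g`.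
[folklore] -/
theorem coeff_homog_cons (g : MvPolynomial (Fin q) ℤ) (β : Fin q →₀ ℕ) :
    (homog g).coeff (Finsupp.cons (g.totalDegree - β.degree) β) = g.coeff β := by
  classical
  unfold homog
  rw [coeff_sum]
  simp only [coeff_monomial]
  rw [Finset.sum_eq_single β]
  · simp
  · intro β' _ hne
    rw [if_neg]
    exact fun h => hne (cons_sub_injective _ h)
  · intro hβ
    simp [notMem_support_iff.mp hβ]

/-- The support of `ʰg` is the image of the support of `g`. [folklore] -/
theorem support_homog (g : MvPolynomial (Fin q) ℤ) :
    (homog g).support =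
      g.support.image fun β => Finsupp.cons (g.totalDegree - β.degree) β := by
  classical
  ext γ
  simp only [Finset.mem_image, mem_support_iff]
  constructor
  · intro h
    unfold homog at h
    rw [coeff_sum] at h
    obtain ⟨β, hβ, hne⟩ := Finset.exists_ne_zero_of_sum_ne_zero h
    rw [coeff_monomial] at hne
    split_ifs at hne with hγ
    · exact ⟨β, mem_support_iff.mp hβ, hγ⟩
    · exact absurd rfl hne
  · rintro ⟨β, hβ, rfl⟩
    rwa [coeff_homog_cons]

/-- Every exponent of `ʰg` has degree `deg g`. [folklore] -/
theorem isHomogeneous_homog (g : MvPolynomial (Fin q) ℤ) :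
    (homog g).IsHomogeneous g.totalDegree := by
  classical
  unfold homog
  refine IsHomogeneous.sum _ _ _ fun β hβ => isHomogeneous_monomial _ ?_
  have hle : β.degree ≤ g.totalDegree := by
    rw [Finsupp.degree_apply]
    exact le_totalDegree hβ
  rw [Finsupp.degree_eq_sum, Fin.sum_univ_succ]
  simp only [Finsupp.cons_zero, Finsupp.cons_succ]
  rw [← Finsupp.degree_eq_sum]
  omega

/-- `ʰg` vanishes only if `g` does. [folklore] -/
theorem homog_eq_zero_iff (g : MvPolynomial (Fin q) ℤ) : homog g = 0 ↔ g = 0 := by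
  constructor
  · intro h
    by_contra hg
    obtain ⟨β, hβ⟩ := exists_coeff_ne_zero hg
    apply hβ
    rw [← coeff_homog_cons, h, coeff_zero]
  · rintro rfl
    simp [homog]

/-- `deg ʰg = deg g`. [folklore] -/
theorem totalDegree_homog (g : MvPolynomial (Fin q) ℤ) : (homog g).totalDegree = g.totalDegree := by
  by_cases hg : g = 0
  · subst hg
    simp [homog]
  · exact (isHomogeneous_homog g).totalDegree (fun h => hg ((homog_eq_zero_iff g).mp h))

/-- **Dehomogenisation by evaluation**: `ʰg(1, z₁, …, z_q) = g(z₁, …, z_q)` in any `ℤ`-algebra.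
[folklore] -/
theorem aeval_homog_cons_one {A : Type*} [CommRing A] (z : Fin q → A) (g : MvPolynomial (Fin q) ℤ) :
    aeval (Fin.cons 1 z : Fin (q + 1) → A) (homog g) = aeval z g := by
  classical
  conv_rhs => rw [g.as_sum]
  unfold homog
  rw [map_sum, map_sum]
  refine Finset.sum_congr rfl fun β _ => ?_
  rw [aeval_monomial, aeval_monomial]
  congr 1
  rw [Finsupp.prod_fintype _ _ (fun i => by simp), Finsupp.prod_fintype _ _ (fun i => by simp),
    Fin.prod_univ_succ]
  simp [Finsupp.cons_zero, Finsupp.cons_succ]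

/-- The `ℓ¹`-length is unchanged by homogenisation (same multiset of coefficients). [folklore] -/
theorem sum_abs_coeff_homog (g : MvPolynomial (Fin q) ℤ) :
    ∑ γ ∈ (homog g).support, |(((homog g).coeff γ : ℤ) : ℝ)| =
      ∑ β ∈ g.support, |((g.coeff β : ℤ) : ℝ)| := by
  classical
  rw [support_homog, Finset.sum_image fun β _ β' _ h => cons_sub_injective _ h]
  refine Finset.sum_congr rfl fun β _ => ?_
  rw [coeff_homog_cons]

/-! ### Scaling of homogeneous forms and the norm of a form -/

/-- **Forms scale**: `F(c y) = c^d F(y)` for `F` homogeneous of degree `d`. [folklore] -/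
theorem aeval_smul_of_isHomogeneous {m : ℕ} {F : MvPolynomial (Fin m) ℤ} {d : ℕ}
    (hF : F.IsHomogeneous d) (c : ℂ) (y : Fin m → ℂ) :
    aeval (c • y) F = c ^ d * aeval y F := by
  classical
  rw [aeval_def, aeval_def, eval₂_eq', eval₂_eq', Finset.mul_sum]
  refine Finset.sum_congr rfl fun β hβ => ?_
  have hdeg : d = ∑ i, β i := by
    rw [hF.degree_eq_sum_deg_support hβ, ← Finsupp.degree_apply, Finsupp.degree_eq_sum]
  simp only [Pi.smul_apply, smul_eq_mul, mul_pow, Finset.prod_mul_distrib,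
    Finset.prod_pow_eq_pow_sum, ← hdeg]
  ring

/-- A multinomial coefficient `|β|!/β!` on `m` letters is at most `m^{|β|}` (a term of the
multinomial expansion of `(1 + ⋯ + 1)^{|β|}`). [folklore] -/
theorem multinomial_le_pow {m : ℕ} (β : Fin m →₀ ℕ) : β.multinomial ≤ m ^ β.degree := by
  classical
  have hmem : (⇑β : Fin m → ℕ) ∈ Finset.univ.piAntidiag β.degree := by
    rw [Finset.mem_piAntidiag]
    exact ⟨(Finsupp.degree_eq_sum β).symm, fun _ _ => Finset.mem_univ _⟩
  have key := Finset.sum_pow_eq_sum_piAntidiag (Finset.univ : Finset (Fin m)) (fun _ => (1 : ℕ))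
    β.degree
  simp only [Finset.sum_const, Finset.card_univ, Fintype.card_fin, smul_eq_mul, mul_one,
    one_pow, Finset.prod_const_one] at key
  rw [key, Finsupp.multinomial_eq_of_support_subset (Finset.subset_univ _)]
  exact Finset.single_le_sum (f := fun k => Nat.multinomial Finset.univ k) (fun _ _ => Nat.zero_le _)
    hmem

/-- **A non-zero integer form is not too small in norm**: `‖F‖² ≥ m^{-d}` for `F ≠ 0` homogeneous
of degree `d` in `m` variables (some coefficient is a non-zero integer and its weight is
`≤ m^d`). [folklore] -/
theorem inv_pow_le_formNorm_sq {m : ℕ} {F : MvPolynomial (Fin m) ℤ} {d : ℕ} (hF : F.IsHomogeneous d)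
    (h0 : F ≠ 0) (hm : 1 ≤ m) : ((m : ℝ) ^ d)⁻¹ ≤ formNorm F ^ 2 := by
  obtain ⟨β, hβ⟩ := exists_coeff_ne_zero h0
  have hdeg : β.degree = d := by
    rw [hF.degree_eq_sum_deg_support (mem_support_iff.mpr hβ), Finsupp.degree_apply]
  have h1 : (1 : ℝ) ≤ ((F.coeff β : ℤ) : ℝ) ^ 2 := by
    have : (1 : ℤ) ≤ |F.coeff β| := Int.one_le_abs hβ
    have h' : (1 : ℝ) ≤ |((F.coeff β : ℤ) : ℝ)| := by exact_mod_cast this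
    nlinarith [abs_nonneg ((F.coeff β : ℤ) : ℝ), sq_abs ((F.coeff β : ℤ) : ℝ)]
  have h2 := coeff_sq_le_multinomial_mul_formNorm_sq F β
  have h3 : (β.multinomial : ℝ) ≤ (m : ℝ) ^ d := by
    rw [← hdeg]; exact_mod_cast multinomial_le_pow β
  have hmpos : (0 : ℝ) < (m : ℝ) ^ d := pow_pos (by exact_mod_cast hm) d
  have key : (1 : ℝ) ≤ (m : ℝ) ^ d * formNorm F ^ 2 :=
    calc (1 : ℝ) ≤ ((F.coeff β : ℤ) : ℝ) ^ 2 := h1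
      _ ≤ (β.multinomial : ℝ) * formNorm F ^ 2 := h2
      _ ≤ (m : ℝ) ^ d * formNorm F ^ 2 := mul_le_mul_of_nonneg_right h3 (sq_nonneg _)
  rw [inv_le_iff_one_le_mul₀ hmpos]
  linarith [mul_comm ((m : ℝ) ^ d) (formNorm F ^ 2)]

/-- `‖F‖ ≤ ∑ |F_α|` (the weights are `≥ 1`). [folklore] -/
theorem formNorm_le_sum_abs_coeff {m : ℕ} (F : MvPolynomial (Fin m) ℤ) :
    formNorm F ≤ ∑ α ∈ F.support, |((F.coeff α : ℤ) : ℝ)| := by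
  have hnn : ∀ α : Fin m →₀ ℕ, 0 ≤ |((F.coeff α : ℤ) : ℝ)| := fun α => abs_nonneg _
  unfold formNorm
  refine Real.sqrt_le_iff.mpr ⟨Finset.sum_nonneg fun α _ => hnn α, ?_⟩
  calc ∑ α ∈ F.support, ((F.coeff α : ℤ) : ℝ) ^ 2 / (α.multinomial : ℝ)
      ≤ ∑ α ∈ F.support, |((F.coeff α : ℤ) : ℝ)| ^ 2 := by
        refine Finset.sum_le_sum fun α _ => ?_
        rw [sq_abs]
        refine div_le_self (sq_nonneg _) ?_
        exact_mod_cast Nat.pos_of_ne_zero (Nat.multinomial_pos _ _).ne'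
    _ ≤ (∑ α ∈ F.support, |((F.coeff α : ℤ) : ℝ)|) ^ 2 :=
        Finset.sum_sq_le_sq_sum_of_nonneg fun α _ => hnn α

/-! ### The projective ball around `(1 : θ)` inside the affine polydisc around `θ` -/

/-- `|x₀y_j - x_jy₀|² ≤ ‖x ∧ y‖²` for every `j`: one term of the sum. More usefully, the whole row
`i = 0`: `∑ⱼ |x₀yⱼ - xⱼy₀|² ≤ ‖x ∧ y‖²`. [folklore] -/
theorem sum_row_zero_le_wedgeNormSq {q : ℕ} (x y : Fin (q + 1) → ℂ) :
    ∑ j, ‖x 0 * y j - x j * y 0‖ ^ 2 ≤ wedgeNormSq x y := by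
  unfold wedgeNormSq
  set a : Fin (q + 1) → Fin (q + 1) → ℝ := fun i j => ‖x i * y j - x j * y i‖ ^ 2 with ha
  have hsymm : ∀ i j, a i j = a j i := fun i j => by
    simp only [ha]
    rw [← norm_neg]
    congr 1
    ring
  have hnn : ∀ i j, 0 ≤ a i j := fun i j => by positivity
  have h00 : a 0 0 = 0 := by simp [ha]
  show ∑ j, a 0 j ≤ (∑ i, ∑ j, a i j) / 2
  rw [le_div_iff₀ (by norm_num : (0 : ℝ) < 2)]
  calc (∑ j, a 0 j) * 2 = ∑ j, a 0 j + ∑ i, a i 0 := by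
        rw [mul_two]
        congr 1
        exact Finset.sum_congr rfl fun i _ => hsymm 0 i
    _ = ∑ j, a 0 j + ∑ i : Fin q, a i.succ 0 := by
        rw [Fin.sum_univ_succ (f := fun i => a i 0), h00, zero_add]
    _ ≤ ∑ j, a 0 j + ∑ i : Fin q, ∑ j, a i.succ j := by
        gcongr with i
        exact Finset.single_le_sum (f := fun j => a i.succ j) (fun j _ => hnn _ _)
          (Finset.mem_univ 0)
    _ = ∑ i, ∑ j, a i j := by
        rw [Fin.sum_univ_succ (f := fun i => ∑ j, a i j)]

/-- The row bound in terms of the distance: for `x = (1 : θ)` and `y ≠ 0`,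
`∑ⱼ |yⱼ - xⱼy₀|² ≤ (Dist(x, y) ‖x‖ ‖y‖)²`. [folklore] -/
theorem sum_sq_le_of_sineDist {q : ℕ} (θ : Fin q → ℂ) {y : Fin (q + 1) → ℂ} (hy : y ≠ 0) :
    ∑ j, ‖y j - (Fin.cons 1 θ : Fin (q + 1) → ℂ) j * y 0‖ ^ 2 ≤
      (sineDist (Fin.cons 1 θ : Fin (q + 1) → ℂ) y * projNorm (Fin.cons 1 θ : Fin (q + 1) → ℂ) *
        projNorm y) ^ 2 := by
  set x : Fin (q + 1) → ℂ := Fin.cons 1 θ with hx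
  have hx0 : x 0 = 1 := by simp [hx]
  have hxpos : 0 < projNorm x := by
    have := norm_apply_le_projNorm x 0
    rw [hx0, norm_one] at this
    linarith
  have hypos : 0 < projNorm y := projNorm_pos hy
  have hD : 0 < projNorm x * projNorm y := mul_pos hxpos hypos
  have hW := sum_row_zero_le_wedgeNormSq x y
  simp only [hx0, one_mul] at hW
  have hsq : Real.sqrt (wedgeNormSq x y) = sineDist x y * projNorm x * projNorm y := by
    rw [sineDist, mul_assoc, div_mul_cancel₀ _ hD.ne']
  calc ∑ j, ‖y j - x j * y 0‖ ^ 2 ≤ wedgeNormSq x y := hW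
    _ = Real.sqrt (wedgeNormSq x y) ^ 2 := (Real.sq_sqrt (wedgeNormSq_nonneg x y)).symm
    _ = (sineDist x y * projNorm x * projNorm y) ^ 2 := by rw [hsq]

/-- **The projective ball around `(1 : θ)` of radius `r` with `2r‖(1 : θ)‖ ≤ 1` lies in the
affine chart `y₀ ≠ 0`, inside the polydisc `maxⱼ |yⱼ/y₀ - θⱼ| ≤ 2r ‖(1 : θ)‖²`.** [folklore] -/
theorem polydisc_of_sineDist_le {q : ℕ} (θ : Fin q → ℂ) {y : Fin (q + 1) → ℂ} (hy : y ≠ 0)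
    {r : ℝ} (hr0 : 0 ≤ r) (hr : 4 * (r * projNorm (Fin.cons 1 θ : Fin (q + 1) → ℂ)) ^ 2 ≤ 1)
    (hd : sineDist (Fin.cons 1 θ : Fin (q + 1) → ℂ) y ≤ r) :
    y 0 ≠ 0 ∧ ∀ j : Fin q, ‖y j.succ / y 0 - θ j‖ ≤
      2 * r * projNorm (Fin.cons 1 θ : Fin (q + 1) → ℂ) ^ 2 := by
  set x : Fin (q + 1) → ℂ := Fin.cons 1 θ with hx
  have hx0 : x 0 = 1 := by simp [hx]
  have hxs : ∀ j : Fin q, x j.succ = θ j := fun j => by simp [hx]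
  have hx1 : 1 ≤ projNorm x := by
    have := norm_apply_le_projNorm x 0
    rwa [hx0, norm_one] at this
  have hxpos : 0 < projNorm x := by linarith
  -- `(r‖x‖)² ≤ 1/4`
  have hrx : (r * projNorm x) ^ 2 ≤ 1 / 4 := by linarith
  -- Step 1: `y₀ ≠ 0`
  have hy0 : y 0 ≠ 0 := by
    intro h0
    have hrow := sum_sq_le_of_sineDist θ hy
    simp only [h0, mul_zero, sub_zero] at hrow
    rw [← projNorm_sq] at hrow
    have hypos : 0 < projNorm y := projNorm_pos hy
    have hdn : 0 ≤ sineDist x y := sineDist_nonneg x y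
    -- `‖y‖² ≤ (Dist ‖x‖ ‖y‖)² ≤ (r ‖x‖ ‖y‖)² ≤ ‖y‖²/4`
    have h1 : (sineDist x y * projNorm x * projNorm y) ^ 2 ≤ (r * projNorm x * projNorm y) ^ 2 := by
      gcongr
    have h2 : (r * projNorm x * projNorm y) ^ 2 ≤ projNorm y ^ 2 / 4 := by
      rw [mul_pow]
      nlinarith [sq_nonneg (projNorm y)]
    nlinarith
  refine ⟨hy0, fun j => ?_⟩
  -- Step 2: normalise `y₀ = 1`
  set y' : Fin (q + 1) → ℂ := (y 0)⁻¹ • y with hy'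
  have hy'0 : y' 0 = 1 := by simp [hy', hy0]
  have hy'ne : y' ≠ 0 := fun h => by simp [h] at hy'0
  have hy's : ∀ i, y' i = y i / y 0 := fun i => by
    simp [hy', div_eq_inv_mul]
  have hd' : sineDist x y' ≤ r := by rwa [hy', sineDist_smul_right (inv_ne_zero hy0)]
  have hrow := sum_sq_le_of_sineDist θ hy'ne
  simp only [hy'0, mul_one] at hrow
  -- `E² = ∑ |y'_j - x_j|²`, `‖y'‖² ≤ 2‖x‖² + 2E²`
  set E2 : ℝ := ∑ i, ‖y' i - x i‖ ^ 2 with hE2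
  have hE2nn : 0 ≤ E2 := Finset.sum_nonneg fun i _ => sq_nonneg _
  have hY : projNorm y' ^ 2 ≤ 2 * projNorm x ^ 2 + 2 * E2 := by
    rw [projNorm_sq, projNorm_sq, hE2, Finset.mul_sum, Finset.mul_sum, ← Finset.sum_add_distrib]
    refine Finset.sum_le_sum fun i _ => ?_
    have htri : ‖y' i‖ ≤ ‖x i‖ + ‖y' i - x i‖ := by
      calc ‖y' i‖ = ‖x i + (y' i - x i)‖ := by ring_nf
        _ ≤ ‖x i‖ + ‖y' i - x i‖ := norm_add_le _ _
    nlinarith [norm_nonneg (y' i), norm_nonneg (x i), norm_nonneg (y' i - x i),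
      sq_nonneg (‖x i‖ - ‖y' i - x i‖)]
  -- `E² ≤ (r‖x‖‖y'‖)² ≤ (r‖x‖)² (2‖x‖² + 2E²) ≤ (r‖x‖)² 2‖x‖² + E²/2`
  have hdn : 0 ≤ sineDist x y' := sineDist_nonneg x y'
  have hE : E2 ≤ (r * projNorm x) ^ 2 * projNorm y' ^ 2 := by
    have hle : sineDist x y' * projNorm x * projNorm y' ≤ r * projNorm x * projNorm y' :=
      mul_le_mul_of_nonneg_right (mul_le_mul_of_nonneg_right hd' hxpos.le) (projNorm_nonneg _)
    have hnn : 0 ≤ sineDist x y' * projNorm x * projNorm y' :=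
      mul_nonneg (mul_nonneg hdn hxpos.le) (projNorm_nonneg _)
    calc E2 ≤ (sineDist x y' * projNorm x * projNorm y') ^ 2 := hrow
      _ ≤ (r * projNorm x * projNorm y') ^ 2 := pow_le_pow_left₀ hnn hle 2
      _ = (r * projNorm x) ^ 2 * projNorm y' ^ 2 := by ring
  have hE4 : E2 ≤ 4 * r ^ 2 * projNorm x ^ 4 := by
    have h1 : E2 ≤ (r * projNorm x) ^ 2 * (2 * projNorm x ^ 2 + 2 * E2) :=
      hE.trans (mul_le_mul_of_nonneg_left hY (sq_nonneg _))
    nlinarith [sq_nonneg (projNorm x), sq_nonneg r]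
  -- the `j`-th term
  have hj : ‖y' j.succ - x j.succ‖ ^ 2 ≤ E2 :=
    Finset.single_le_sum (f := fun i => ‖y' i - x i‖ ^ 2) (fun i _ => sq_nonneg _)
      (Finset.mem_univ _)
  rw [hxs, hy's] at hj
  have hfin : ‖y j.succ / y 0 - θ j‖ ^ 2 ≤ (2 * r * projNorm x ^ 2) ^ 2 := by nlinarith
  exact (pow_le_pow_iff_left₀ (norm_nonneg _) (by positivity) two_ne_zero).mp hfin


end Ch8Transfer

/-! ### Assembly: Diaz's Théorème 1 from Corollary 1.1 of LNM 1752 Ch. 8 and the zero lemma -/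

section Assembly

open Filter Real Literature.NumberTheory.Transcendental.Asymp
  Literature.NumberTheory.Transcendental.Chudnovsky DiazThm1 Ch8Transfer Philippon

/-- The `ℓ¹`-length of `ChudnovskyHeights.lean` is the sum of the absolute values of the
coefficients. [folklore] -/
theorem l1_eq_sum_abs {σ : Type*} (P : MvPolynomial σ ℤ) :
    l1 P = ∑ α ∈ P.support, |((P.coeff α : ℤ) : ℝ)| := by
  simp only [l1, wnorm]
  refine Finset.sum_congr rfl fun α _ => ?_
  simp

/-- `(j : ℕ) ↦ j + N₁` tends to `∞` in `ℝ`. [folklore] -/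
theorem tendsto_natCast_add_atTop (N₁ : ℕ) :
    Tendsto (fun j : ℕ => (j : ℝ) + N₁) atTop atTop :=
  tendsto_atTop_add_const_right _ _ tendsto_natCast_atTop_atTop

set_option maxHeartbeats 1600000 in
/-- **Diaz 1989, §II-4-3 (the conclusion) through LNM 1752 Ch. 8 Corollary 1.1, exponent-free
form.** If all large `X` are good for `u ∈ ℂⁿ`, `v ∈ ℂ^{m'+1}` (`DiazThm1.GoodX`: Siegel's step
applies, the family `𝓕_X` of the `Q_{μj}` is small at `θ = (v_k, e^{u_hv_k})`, has degrees and
logarithmic lengths `≤ c_δΦ₀(X)`, and no common zero in the polydisc of radius `e^{-ρ(X)}`), then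
Ch. 8 Cor. 1.1 applied at `x = (1 : θ)` to the homogenised family (the transfer described in the
module docstring) gives `trdeg_ℚ ℚ(v_k, e^{u_hv_k}) ≥ [(mn+m)/(m+n)]` (`m = m' + 1 ≥ 2`, `n ≥ 1`).
This is the proof of `Diaz1989_thm1_of_ch8` from the point where (HT1) has been consumed by
`DiazThm1.eventually_goodX`; stating it for an arbitrary eventually-good pair lets other
hypotheses that make large `X` good (e.g. Laurent's measures, `DiazMainProofs.lean`) reuse it.
[cite: Diaz1989, §II-4-3 p. 16]
[cite: NesterenkoPhilippon2001, Ch. 8 §1 Corollary 1.1 (PDF pp. 165–166)] -/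
theorem le_trdeg_of_eventually_goodX_ch8 (hC : NesterenkoPhilippon2001_ch8_cor_1_1) {m' n : ℕ}
    (hm' : 1 ≤ m') (hn : 1 ≤ n) (u : Fin n → ℂ) (v : Fin (m' + 1) → ℂ)
    (hgood : ∀ᶠ X in atTop, GoodX u v X) :
    (((((m' + 1) * n + (m' + 1)) / ((m' + 1) + n) : ℕ)) : Cardinal) ≤ Algebra.trdeg ℚ
        ↥(IntermediateField.adjoin ℚ (Set.range v ∪
          Set.range fun p : Fin n × Fin (m' + 1) => Complex.exp (u p.1 * v p.2))) := by
  have hm1 : 1 ≤ m' + 1 := by omega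
  -- the exponent `k + 1 = [(mn+m)/(m+n)]`
  obtain ⟨hk1, hk, hkn⟩ := exponent_facts (n := n) hm1 hn
  set k : ℕ := ((m' + 1) * n + (m' + 1)) / ((m' + 1) + n) - 1 with hkdef
  -- the transported point `θ ∈ ℂ^q` and the projective point `x = (1 : θ)`
  set eV := varEquiv (m' + 1) n with heV
  set q : ℕ := (m' + 1) + n * (m' + 1) with hqdef
  set θq : Fin q → ℂ := theta u v ∘ eV.symm with hθq
  have hkq : k ≤ q := by
    have : n ≤ n * (m' + 1) := Nat.le_mul_of_pos_right n (by omega)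
    omega
  set xP : Fin (q + 1) → ℂ := Fin.cons 1 θq with hxP
  have hxP0 : xP 0 = 1 := by simp [hxP]
  have hx1 : 1 ≤ projNorm xP := by
    have := norm_apply_le_projNorm xP 0
    rwa [hxP0, norm_one] at this
  have hxpos : 0 < projNorm xP := by linarith
  -- constants
  have hcS := cS_pos (m := m' + 1) (n := n) (by omega) hn
  have hcd1 : (1 : ℝ) ≤ cdelta (m' + 1) n := one_le_cdelta
  have hcd0 : (0 : ℝ) < cdelta (m' + 1) n := by linarith
  set g' : ℝ := (2 : ℝ) ^ (((m' + 1 : ℕ) : ℝ) * (n + 1) + 1) with hg'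
  have hg'1 : 1 ≤ g' := Real.one_le_rpow (by norm_num) (by positivity)
  set Lx : ℝ := |Real.log (2 * projNorm xP)| with hLx
  set Lx2 : ℝ := |Real.log (2 * projNorm xP ^ 2)| with hLx2
  set σ₀ : ℝ := 1 + 2 * Lx + 2 / cS (m' + 1) n * (16 * ((n : ℝ) + 1) * g' + Lx2) with hσ₀
  have hLx0 : 0 ≤ Lx := abs_nonneg _
  have hLx20 : 0 ≤ Lx2 := abs_nonneg _
  have hσ₀1 : 1 ≤ σ₀ := by
    have : 0 ≤ 2 / cS (m' + 1) n * (16 * ((n : ℝ) + 1) * g' + Lx2) := by positivity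
    linarith
  have hσ₀0 : 0 ≤ σ₀ := by linarith
  set Lq : ℝ := Real.log ((q : ℝ) + 1) with hLq
  have hLq0 : 0 ≤ Lq := Real.log_nonneg (by simp)
  set A : ℝ := 2 / cS (m' + 1) n * (Lq * cdelta (m' + 1) n + cdelta (m' + 1) n + σ₀ ^ (k + 1) + 2)
    with hAdef
  have hA0 : 0 ≤ A := by positivity
  -- thresholds: every `X ≥ X₀` is good, `A Φ₀^{k+1} ≤ Ψ₀`, `X ≥ e` and `X ≥ σ₀^{k+1} + 1`
  have hev := hgood.and
    ((eventually_Phi0_pow_le_Psi0 (m := m' + 1) (n := n) hk hkn A).and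
      (eventually_ge_atTop (max (Real.exp 1) (σ₀ ^ (k + 1) + 1))))
  obtain ⟨X₀, hX₀⟩ := Filter.eventually_atTop.mp hev
  set N₁ : ℕ := ⌈max X₀ 0⌉₊ + 3 with hN₁def
  have hN₁3 : 3 ≤ N₁ := by omega
  have hXN : ∀ N : ℕ, X₀ ≤ (N : ℝ) + N₁ := fun N => by
    have h1 : X₀ ≤ ⌈max X₀ 0⌉₊ := (le_max_left _ _).trans (Nat.le_ceil _)
    have h2 : (N₁ : ℝ) = (⌈max X₀ 0⌉₊ : ℝ) + 3 := by rw [hN₁def]; push_cast; ring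
    have h3 : (0 : ℝ) ≤ N := Nat.cast_nonneg N
    linarith
  have hG : ∀ N : ℕ, GoodX u v ((N : ℝ) + N₁) := fun N => (hX₀ _ (hXN N)).1
  have hXe : ∀ N : ℕ, Real.exp 1 ≤ (N : ℝ) + N₁ := fun N =>
    (le_max_left _ _).trans (hX₀ _ (hXN N)).2.2
  have hX1 : ∀ N : ℕ, (1 : ℝ) ≤ (N : ℝ) + N₁ := fun N =>
    le_trans (by have := Real.add_one_le_exp (1 : ℝ); linarith) (hXe N)
  have hX2 : ∀ N : ℕ, (2 : ℝ) ≤ (N : ℝ) + N₁ := fun N => by linarith [(hG N).three_le]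
  have hΦ1 : ∀ N : ℕ, 1 ≤ Phi0 (m' + 1) n ((N : ℝ) + N₁) := fun N =>
    le_trans (hX1 N) (X_le_Phi0 (n := n) hm1 (hXe N))
  have hΨ1 : ∀ N : ℕ, 1 ≤ Psi0 (m' + 1) n ((N : ℝ) + N₁) := fun N =>
    one_le_scale (by positivity) zero_le_one (hXe N)
  have hE2 : ∀ N : ℕ, A * Phi0 (m' + 1) n ((N : ℝ) + N₁) ≤ Psi0 (m' + 1) n ((N : ℝ) + N₁) :=
    fun N => by
    have h := (hX₀ _ (hXN N)).2.1
    refine le_trans (mul_le_mul_of_nonneg_left ?_ hA0) h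
    exact le_self_pow₀ (hΦ1 N) (Nat.succ_ne_zero k)
  have hE3 : ∀ N : ℕ, σ₀ ^ (k + 1) + 1 ≤ cdelta (m' + 1) n * Phi0 (m' + 1) n ((N : ℝ) + N₁) :=
    fun N => by
    have h1 : σ₀ ^ (k + 1) + 1 ≤ (N : ℝ) + N₁ := (le_max_right _ _).trans (hX₀ _ (hXN N)).2.2
    have h2 : (N : ℝ) + N₁ ≤ Phi0 (m' + 1) n ((N : ℝ) + N₁) := X_le_Phi0 (n := n) hm1 (hXe N)
    have h3 : Phi0 (m' + 1) n ((N : ℝ) + N₁) ≤ cdelta (m' + 1) n * Phi0 (m' + 1) n ((N : ℝ) + N₁) :=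
      le_mul_of_one_le_left (by linarith [hΦ1 N]) hcd1
    linarith
  -- the growth functions
  set δF : ℕ → ℝ := sigF (m' + 1) n N₁ with hδF
  set τF : ℕ → ℝ := fun j => δF j + (σ₀ ^ (k + 1) + 1) with hτF
  set UF : ℕ → ℝ := fun j => SF (m' + 1) n N₁ j * (1 / 2) with hUF
  have hδF1 : ∀ j, 1 ≤ δF j := fun j => one_le_sigF hN₁3 hm1 j
  have hUF : ∀ j, UF j = cS (m' + 1) n * Psi0 (m' + 1) n ((j : ℝ) + N₁) / 2 := fun j => by
    simp only [hUF, SF]; ring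
  have hUFhalf : ∀ j, 1 / 2 ≤ UF j := fun j => by
    rw [hUF]; linarith [(hG j).S_ge]
  have hτU : ∀ j, τF j < UF j := fun j => by
    -- `c_δΦ₀ + σ₀^{k+1} + 1 < c_SΨ₀/2` from `A Φ₀ ≤ Ψ₀`
    have h := hE2 j
    simp only [hτF, hδF, sigF]
    rw [hUF]
    have hΦ := hΦ1 j
    have hA' : A * Phi0 (m' + 1) n ((j : ℝ) + N₁) ≥ 2 / cS (m' + 1) n *
        (cdelta (m' + 1) n * Phi0 (m' + 1) n ((j : ℝ) + N₁) + σ₀ ^ (k + 1) + 2) := by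
      rw [hAdef, mul_assoc]
      refine mul_le_mul_of_nonneg_left ?_ (by positivity)
      have hσk : 0 ≤ σ₀ ^ (k + 1) := by positivity
      nlinarith [mul_nonneg hLq0 hcd0.le]
    have key : 2 / cS (m' + 1) n *
        (cdelta (m' + 1) n * Phi0 (m' + 1) n ((j : ℝ) + N₁) + σ₀ ^ (k + 1) + 2) ≤
        Psi0 (m' + 1) n ((j : ℝ) + N₁) := le_trans hA' h
    rw [div_mul_eq_mul_div, div_le_iff₀ hcS] at key
    nlinarith
  -- the criterion
  have main := hC q k xP δF τF (fun _ => σ₀) UF hkq (by rw [hxP0]; exact one_ne_zero)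
    (sigF_mono hN₁3) ((sigF_mono hN₁3).add_const _) monotone_const
    ((SF_mono hN₁3).mul_const (by norm_num)) hδF1 (fun _ => hσ₀1)
    (fun j => le_add_of_nonneg_right (by positivity))
    (fun j => by simp only [hτF]; linarith [hδF1 j])
    hτU ?ratio ?tendτ ?family
  case ratio =>
    -- `U/(τ δ^k σ₀^{k+1}) ≥ Ψ₀/(B Φ₀^{k+1}) → ∞`
    set B : ℝ := 4 * σ₀ ^ (k + 1) * cdelta (m' + 1) n ^ (k + 1) / cS (m' + 1) n with hB
    have hB0 : 0 < B := by positivity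
    have hlow : ∀ j : ℕ, Psi0 (m' + 1) n ((j : ℝ) + N₁) / (B * Phi0 (m' + 1) n ((j : ℝ) + N₁) ^ (k + 1))
        ≤ UF j / (τF j * δF j ^ k * σ₀ ^ (k + 1)) := by
      intro j
      have hΦ := hΦ1 j
      have hΦ0 : 0 < Phi0 (m' + 1) n ((j : ℝ) + N₁) := by linarith
      have hτ2 : τF j ≤ 2 * δF j := by
        simp only [hτF, hδF, sigF]; linarith [hE3 j]
      have hτ0 : 0 < τF j := by simp only [hτF]; linarith [hδF1 j, pow_nonneg hσ₀0 (k + 1)]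
      have hden : 0 < τF j * δF j ^ k * σ₀ ^ (k + 1) := by
        have := hδF1 j; positivity
      rw [div_le_div_iff₀ (by positivity) hden, hUF]
      have hδ0 : 0 ≤ δF j := by linarith [hδF1 j]
      calc Psi0 (m' + 1) n ((j : ℝ) + N₁) * (τF j * δF j ^ k * σ₀ ^ (k + 1))
          ≤ Psi0 (m' + 1) n ((j : ℝ) + N₁) * (2 * δF j * δF j ^ k * σ₀ ^ (k + 1)) := by
            refine mul_le_mul_of_nonneg_left ?_ (by linarith [hΨ1 j])
            gcongr
        _ = cS (m' + 1) n * Psi0 (m' + 1) n ((j : ℝ) + N₁) / 2 *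
            (B * Phi0 (m' + 1) n ((j : ℝ) + N₁) ^ (k + 1)) := by
            simp only [hδF, sigF, hB]
            field_simp
            ring
    have hf : Tendsto (fun j : ℕ => Psi0 (m' + 1) n ((j : ℝ) + N₁) /
        (B * Phi0 (m' + 1) n ((j : ℝ) + N₁) ^ (k + 1))) atTop atTop := by
      refine Filter.tendsto_atTop.mpr fun b => ?_
      have hev' := (eventually_Phi0_pow_le_Psi0 (m := m' + 1) (n := n) hk hkn (max b 0 * B)).and
        (eventually_ge_atTop (Real.exp 1))
      have := (tendsto_natCast_add_atTop N₁).eventually hev'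
      filter_upwards [this] with j hj
      obtain ⟨hj, hje⟩ := hj
      have hΦ : 1 ≤ Phi0 (m' + 1) n ((j : ℝ) + N₁) :=
        le_trans (le_trans (by have := Real.add_one_le_exp (1 : ℝ); linarith) hje)
          (X_le_Phi0 (n := n) hm1 hje)
      have hpos : 0 < B * Phi0 (m' + 1) n ((j : ℝ) + N₁) ^ (k + 1) := by positivity
      rw [le_div_iff₀ hpos]
      calc b * (B * Phi0 (m' + 1) n ((j : ℝ) + N₁) ^ (k + 1))
          ≤ max b 0 * (B * Phi0 (m' + 1) n ((j : ℝ) + N₁) ^ (k + 1)) :=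
            mul_le_mul_of_nonneg_right (le_max_left _ _) hpos.le
        _ = max b 0 * B * Phi0 (m' + 1) n ((j : ℝ) + N₁) ^ (k + 1) := by ring
        _ ≤ _ := hj
    exact tendsto_atTop_mono hlow hf
  case tendτ =>
    refine tendsto_atTop_mono (fun j => ?_) (tendsto_natCast_add_atTop N₁)
    simp only [hτF, hδF]
    have h1 := X_le_sigF (n := n) hN₁3 hm1 j
    have h2 : 0 ≤ σ₀ ^ (k + 1) + 1 := by positivity
    linarith
  case family =>
    intro j
    have hGj := hG j
    set Xj : ℝ := (j : ℝ) + N₁ with hXj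
    refine ⟨Fintype.card (FamIdx (m' + 1) n Xj), fun l =>
      homog (rename eV (famPoly u v Xj ((Fintype.equivFin _).symm l))), ?_, ?_, ?_, ?_, ?_⟩
    · -- forms
      intro l
      dsimp only
      rw [totalDegree_homog]
      exact isHomogeneous_homog _
    · -- degrees
      intro l
      dsimp only
      rw [totalDegree_homog]
      refine le_trans ?_ (hGj.degLen_famPoly ((Fintype.equivFin _).symm l)).1
      exact_mod_cast totalDegree_rename_le _ _
    · -- heights: `log ‖ʰQ‖ ≤ log L(Q) ≤ c_δΦ₀ ≤ τ`
      intro l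
      dsimp only
      set P := famPoly u v Xj ((Fintype.equivFin _).symm l) with hP
      have hτ1 : δF j ≤ τF j := le_add_of_nonneg_right (by positivity)
      have hlen : Real.log (l1 P) ≤ δF j := (hGj.degLen_famPoly ((Fintype.equivFin _).symm l)).2
      unfold formLogHeight
      rcases (formNorm_nonneg (homog (rename eV P))).eq_or_lt with h0 | hpos
      · rw [← h0, Real.log_zero]; linarith [hδF1 j]
      · have hle : formNorm (homog (rename eV P)) ≤ l1 P := by
          refine (formNorm_le_sum_abs_coeff _).trans ?_
          rw [sum_abs_coeff_homog, ← l1_eq_sum_abs, l1_rename_of_injective eV.injective]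
        exact ((Real.log_le_log hpos hle).trans hlen).trans hτ1
    · -- values
      intro l
      dsimp only
      set P := famPoly u v Xj ((Fintype.equivFin _).symm l) with hP
      set H := homog (rename eV P) with hH
      have hθ : θq ∘ eV = theta u v := by funext x; simp [hθq]
      have hval : aeval xP H = aeval (theta u v) P := by
        rw [hH, hxP, aeval_homog_cons_one, aeval_rename, hθ]
      have hsmall : ‖aeval (theta u v) P‖ ≤ Real.exp (-(cS (m' + 1) n * Psi0 (m' + 1) n Xj)) :=
        hGj.small_famPoly _
      by_cases hH0 : H = 0
      · rw [hH0, map_zero, norm_zero, zero_div]; exact (Real.exp_pos _).le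
      · have hHhom : H.IsHomogeneous H.totalDegree := by
          rw [hH, totalDegree_homog]; exact isHomogeneous_homog _
        have hq1 : 1 ≤ q + 1 := by omega
        have hlow := inv_pow_le_formNorm_sq hHhom hH0 hq1
        have hFpos : 0 < formNorm H := by
          rcases (formNorm_nonneg H).eq_or_lt with h0 | h
          · exfalso
            rw [← h0] at hlow
            have : (0 : ℝ) < (((q + 1 : ℕ) : ℝ) ^ H.totalDegree)⁻¹ := by positivity
            linarith
          · exact h
        have hden : 0 < formNorm H * projNorm xP ^ H.totalDegree := by positivity
        rw [div_le_iff₀ hden, hval]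
        refine hsmall.trans ?_
        -- `e^{-c_SΨ₀} ≤ e^{-U} ‖H‖ ≤ e^{-U} ‖H‖ ‖x‖^{deg}`
        have hxd : 1 ≤ projNorm xP ^ H.totalDegree := one_le_pow₀ hx1
        have hdeg : (H.totalDegree : ℝ) ≤ cdelta (m' + 1) n * Phi0 (m' + 1) n Xj := by
          rw [hH, totalDegree_homog]
          refine le_trans ?_ (hGj.degLen_famPoly ((Fintype.equivFin _).symm l)).1
          exact_mod_cast totalDegree_rename_le _ _
        -- `deg · log(q+1) ≤ c_SΨ₀` (from `A Φ₀ ≤ Ψ₀`)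
        have hdl : (H.totalDegree : ℝ) * Lq ≤ cS (m' + 1) n * Psi0 (m' + 1) n Xj := by
          have h := hE2 j
          have hA' : 2 / cS (m' + 1) n * (Lq * cdelta (m' + 1) n) * Phi0 (m' + 1) n Xj ≤
              A * Phi0 (m' + 1) n Xj := by
            refine mul_le_mul_of_nonneg_right ?_ (by linarith [hΦ1 j])
            rw [hAdef]
            refine mul_le_mul_of_nonneg_left ?_ (by positivity)
            nlinarith [pow_nonneg hσ₀0 (k + 1)]
          have key := le_trans hA' h
          rw [div_mul_eq_mul_div, div_mul_eq_mul_div, div_le_iff₀ hcS] at key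
          calc (H.totalDegree : ℝ) * Lq ≤ cdelta (m' + 1) n * Phi0 (m' + 1) n Xj * Lq :=
                mul_le_mul_of_nonneg_right hdeg hLq0
            _ ≤ cS (m' + 1) n * Psi0 (m' + 1) n Xj := by nlinarith [hΨ1 j, hcS]
        -- `‖H‖ ≥ (q+1)^{-deg/2}`, i.e. `‖H‖² ≥ exp(-deg·log(q+1))`
        have hFsq : Real.exp (-((H.totalDegree : ℝ) * Lq)) ≤ formNorm H ^ 2 := by
          refine le_trans (le_of_eq ?_) hlow
          rw [Real.exp_neg, ← Real.exp_log (pow_pos (by positivity : (0:ℝ) < ((q + 1 : ℕ) : ℝ)) _),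
            Real.log_pow]
          push_cast
          rfl
        -- compare squares
        have hU : UF j = cS (m' + 1) n * Psi0 (m' + 1) n Xj / 2 := hUF j
        have hgoal : Real.exp (-(cS (m' + 1) n * Psi0 (m' + 1) n Xj)) ≤
            Real.exp (-UF j) * formNorm H := by
          have h2 : Real.exp (-(cS (m' + 1) n * Psi0 (m' + 1) n Xj)) ^ 2 ≤
              (Real.exp (-UF j) * formNorm H) ^ 2 := by
            rw [mul_pow, ← Real.exp_nat_mul, ← Real.exp_nat_mul]
            push_cast
            calc Real.exp (2 * -(cS (m' + 1) n * Psi0 (m' + 1) n Xj))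
                = Real.exp (2 * -UF j) * Real.exp (-(cS (m' + 1) n * Psi0 (m' + 1) n Xj)) := by
                  rw [← Real.exp_add, hU]; ring_nf
              _ ≤ Real.exp (2 * -UF j) * Real.exp (-((H.totalDegree : ℝ) * Lq)) :=
                  mul_le_mul_of_nonneg_left (Real.exp_le_exp.mpr (neg_le_neg hdl))
                    (Real.exp_pos _).le
              _ ≤ Real.exp (2 * -UF j) * formNorm H ^ 2 :=
                  mul_le_mul_of_nonneg_left hFsq (Real.exp_pos _).le
          exact (pow_le_pow_iff_left₀ (Real.exp_pos _).le
            (mul_nonneg (Real.exp_pos _).le hFpos.le) two_ne_zero).mp h2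
        calc Real.exp (-(cS (m' + 1) n * Psi0 (m' + 1) n Xj)) ≤ Real.exp (-UF j) * formNorm H := hgoal
          _ = Real.exp (-UF j) * formNorm H * 1 := (mul_one _).symm
          _ ≤ Real.exp (-UF j) * (formNorm H * projNorm xP ^ H.totalDegree) := by
              rw [← mul_assoc]
              exact mul_le_mul_of_nonneg_left hxd (mul_nonneg (Real.exp_pos _).le hFpos.le)
    · -- no common zero in the projective ball `Dist(x, y) ≤ e^{-U(j-1)σ₀}`
      intro y hy hdist
      set r : ℝ := Real.exp (-(UF (j - 1) * σ₀)) with hr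
      have hr0 : 0 < r := Real.exp_pos _
      -- (B1) `r ≤ 1/(2‖x‖)`
      have hr1 : r * projNorm xP ≤ 1 / 2 := by
        have h1 : r ≤ Real.exp (-(σ₀ / 2)) := by
          rw [hr]; refine Real.exp_le_exp.mpr ?_
          have := hUFhalf (j - 1)
          nlinarith
        have h2 : Real.exp (-(σ₀ / 2)) ≤ Real.exp (-Lx) := Real.exp_le_exp.mpr (by
          have : 0 ≤ 2 / cS (m' + 1) n * (16 * ((n : ℝ) + 1) * g' + Lx2) := by positivity
          linarith)
        have h3 : Real.exp (-Lx) ≤ Real.exp (-Real.log (2 * projNorm xP)) :=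
          Real.exp_le_exp.mpr (neg_le_neg (le_abs_self _))
        have h4 : Real.exp (-Real.log (2 * projNorm xP)) = 1 / (2 * projNorm xP) := by
          rw [Real.exp_neg, Real.exp_log (by positivity), one_div]
        have h5 : r ≤ 1 / (2 * projNorm xP) := by linarith [h1.trans (h2.trans h3)]
        rw [le_div_iff₀ (by positivity)] at h5
        linarith
      have hr4 : 4 * (r * projNorm xP) ^ 2 ≤ 1 := by
        have : 0 ≤ r * projNorm xP := by positivity
        nlinarith
      -- (B2) `2 r ‖x‖² ≤ e^{-ρ(X_j)}`
      have hΨstep : Psi0 (m' + 1) n Xj ≤ g' * Psi0 (m' + 1) n (((j - 1 : ℕ) : ℝ) + N₁) := by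
        have hΨXj : 1 ≤ Psi0 (m' + 1) n Xj := hΨ1 j
        rcases Nat.eq_zero_or_pos j with hj0 | hjpos
        · have e : (((j - 1 : ℕ) : ℝ)) + N₁ = Xj := by rw [hXj, hj0]
          rw [e]
          exact le_mul_of_one_le_left (by linarith) hg'1
        · have hXj' : Xj = (((j - 1 : ℕ) : ℝ) + N₁) + 1 := by
            rw [hXj, Nat.cast_sub hjpos]; push_cast; ring
          rw [hXj']
          exact scale_add_one_le (by positivity) zero_le_one (hX2 _)
      have hρ : rho (m' + 1) n Xj = 16 * ((n : ℝ) + 1) * Psi0 (m' + 1) n Xj := rfl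
      have hB2 : 2 * r * projNorm xP ^ 2 ≤ Real.exp (-rho (m' + 1) n Xj) := by
        have hx2 : 0 < 2 * projNorm xP ^ 2 := by positivity
        have hlhs : 2 * r * projNorm xP ^ 2 =
            Real.exp (Real.log (2 * projNorm xP ^ 2) - UF (j - 1) * σ₀) := by
          rw [Real.exp_sub, Real.exp_log hx2, hr, Real.exp_neg, div_eq_mul_inv]; ring
        rw [hlhs, Real.exp_le_exp, hρ]
        -- `ρ(X_j) + log(2‖x‖²) ≤ U(j-1) σ₀`
        set Ψ' := Psi0 (m' + 1) n (((j - 1 : ℕ) : ℝ) + N₁) with hΨ'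
        have hΨ'1 : 1 ≤ Ψ' := hΨ1 _
        have hU' : UF (j - 1) = cS (m' + 1) n * Ψ' / 2 := hUF _
        have hσlow : 2 / cS (m' + 1) n * (16 * ((n : ℝ) + 1) * g' + Lx2) ≤ σ₀ := by
          rw [hσ₀]; linarith
        have h1 : UF (j - 1) * σ₀ ≥ Ψ' * (16 * ((n : ℝ) + 1) * g' + Lx2) := by
          rw [hU']
          calc cS (m' + 1) n * Ψ' / 2 * σ₀ ≥
              cS (m' + 1) n * Ψ' / 2 * (2 / cS (m' + 1) n * (16 * ((n : ℝ) + 1) * g' + Lx2)) :=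
                mul_le_mul_of_nonneg_left hσlow (by positivity)
            _ = Ψ' * (16 * ((n : ℝ) + 1) * g' + Lx2) := by field_simp
        have h2 : Real.log (2 * projNorm xP ^ 2) ≤ Lx2 * Ψ' :=
          (le_abs_self _).trans (le_mul_of_one_le_right hLx20 hΨ'1)
        have h3 : 16 * ((n : ℝ) + 1) * Psi0 (m' + 1) n Xj ≤ 16 * ((n : ℝ) + 1) * g' * Ψ' := by
          rw [mul_assoc (16 * ((n : ℝ) + 1))]
          exact mul_le_mul_of_nonneg_left hΨstep (by positivity)
        nlinarith
      -- the polydisc, and a non-vanishing member of the family there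
      obtain ⟨hy0, hclose⟩ := polydisc_of_sineDist_le θq hy hr0.le hr4 hdist
      set z : Fin q → ℂ := fun i => y i.succ / y 0 with hz
      have hball : InBall u v Xj (z ∘ eV) := fun x => by
        rw [norm_sub_rev]
        have := (hclose (eV x)).trans hB2
        simpa [hz, hθq] using this
      obtain ⟨i, hi⟩ := hGj.exists_ne_zero hball
      refine ⟨Fintype.equivFin _ i, ?_⟩
      dsimp only
      rw [Equiv.symm_apply_apply]
      -- `ʰQ(y) = y₀^{deg} ʰQ(y/y₀) = y₀^{deg} Q(z)`
      set H := homog (rename eV (famPoly u v Xj i)) with hH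
      have hHhom : H.IsHomogeneous (rename eV (famPoly u v Xj i)).totalDegree := isHomogeneous_homog _
      have hyy : y = (y 0) • ((y 0)⁻¹ • y) := by
        rw [smul_smul, mul_inv_cancel₀ hy0, one_smul]
      have hy' : (y 0)⁻¹ • y = Fin.cons 1 z := by
        funext i
        refine Fin.cases ?_ (fun i' => ?_) i
        · simp [hy0]
        · simp [hz, div_eq_inv_mul]
      rw [hyy, aeval_smul_of_isHomogeneous hHhom, hy', hH, aeval_homog_cons_one, aeval_rename]
      exact mul_ne_zero (pow_ne_zero _ hy0) hi
  -- conclusion: `ℚ(x₁/x₀, …, x_q/x₀) = ℚ(θ) = ℚ(v, e^{uv})` and `k + 1 = [(mn+m)/(m+n)]`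
  have hrange : (Set.range fun i : Fin q => xP i.succ / xP 0) = Set.range θq := by
    congr 1
    funext i
    simp [hxP]
  have hr : Set.range θq = Set.range v ∪
      Set.range fun p : Fin n × Fin (m' + 1) => Complex.exp (u p.1 * v p.2) := by
    rw [hθq, eV.symm.surjective.range_comp]
    exact Set.Sum.elim_range _ _
  have hfin : (((((m' + 1) * n + (m' + 1)) / ((m' + 1) + n) : ℕ)) : Cardinal) ≤
      Algebra.trdeg ℚ ↥(IntermediateField.adjoin ℚ (Set.range θq)) := by
    rw [← hk1, ← trdeg_adjoin_congr hrange]; exact main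
  exact hfin.trans_eq (trdeg_adjoin_congr hr)

/-- **Diaz 1989, Théorème 1, from LNM 1752 Ch. 8 Corollary 1.1 and the zero lemma.** Same
architecture as `Diaz1989_thm1_of_criterion` (§II-4-3 of Diaz: the family `𝓕_N` of the
`Q_{μj}` at `X_N = N + N₁` is small at `θ = (v_k, e^{u_hv_k})`, of degree and logarithmic length
`≤ c_δΦ₀(X_N)`, without common zero in the polydisc `max|zᵢ - θᵢ| ≤ e^{-ρ(X_N)}`), but the
criterion is now Philippon's in the form of LNM 1752 Ch. 8 Cor. 1.1, applied at the projective
point `x = (1 : θ) ∈ ℙ_q(ℂ)` to the homogenised family, with `δ(j) = c_δΦ₀(X_j)`,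
`τ(j) = δ(j) + σ₀^{k+1} + 1`, `σ ≡ σ₀` constant, `U(j) = c_SΨ₀(X_j)/2`, `k + 1 = [(mn+m)/(m+n)]`:
the homogenised forms have `h₁ ≤ log L ≤ c_δΦ₀`, value `|ʰQ(x)|/(‖ʰQ‖‖x‖^{deg}) ≤
e^{-c_SΨ₀}(q+1)^{deg/2} ≤ e^{-U}`, a projective ball of radius `e^{-U(j-1)σ₀}` around `x` lies in
the polydisc of radius `e^{-ρ(X_j)}` (`polydisc_of_sineDist_le`, `ρ = 16(n+1)Ψ₀` and
`Ψ₀(X+1) ≤ 2^{m(n+1)+1}Ψ₀(X)`), and `U/(τδᵏσ^{k+1}) ≍ Ψ₀/Φ₀^{k+1} → ∞`.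
[cite: Diaz1989, Théorème 1, pp. 1–2; §II-4-3 p. 16]
[cite: NesterenkoPhilippon2001, Ch. 8 §1 Corollary 1.1 (PDF pp. 165–166)] -/
theorem Diaz1989_thm1_of_ch8 (hC : NesterenkoPhilippon2001_ch8_cor_1_1) (hZ : Diaz1989_zeroLemma) :
    Diaz1989_thm1 := by
  intro n m u v hu hv hA hB hn hm
  obtain ⟨m', rfl⟩ : ∃ m', m = m' + 1 := ⟨m - 1, by omega⟩
  have hm' : 1 ≤ m' := by omega
  obtain ⟨c, hc, hZc⟩ := exists_zeroLemmaAt hZ n hn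
  -- Diaz's exponents qualify for (𝒞9) (verbatim from `Diaz1989_thm1_of_criterion`)
  have hn0 : (0 : ℝ) ≤ n := Nat.cast_nonneg n
  have hn1 : (1 : ℝ) ≤ n := by exact_mod_cast hn
  have hm'1 : (1 : ℝ) ≤ m' := by exact_mod_cast hm'
  have hcast : ((m' + 1 - 1 : ℕ) : ℝ) = m' := by simp
  have hmc : ((m' + 1 : ℕ) : ℝ) = (m' : ℝ) + 1 := by push_cast; ring
  have hηa : (0 : ℝ) ≤ ((m' + 1 : ℕ) * (n + 1) : ℝ) / (2 * (m' + 1 : ℕ) + n) := by positivity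
  have hηa' : (2 * ((m' + 1 - 1 : ℕ) : ℝ) + (n + 1)) * (((m' + 1 : ℕ) * (n + 1) : ℝ) /
      (2 * (m' + 1 : ℕ) + n)) < (m' + 1 : ℕ) * (n + 1) := by
    rw [hcast, hmc]
    have hd : (0 : ℝ) < 2 * ((m' : ℝ) + 1) + n := by positivity
    rw [← mul_div_assoc, div_lt_iff₀ hd]
    nlinarith
  have hηb : (0 : ℝ) ≤ ((m' + 1 : ℕ) * (n + 1) : ℝ) / ((m' + 1 : ℕ) + 2 * n + 1) := by positivity
  have hηb' : (((m' + 1 - 1 : ℕ) : ℝ) + 2 * (n + 1)) * (((m' + 1 : ℕ) * (n + 1) : ℝ) /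
      ((m' + 1 : ℕ) + 2 * n + 1)) ≤ (m' + 1 : ℕ) * (n + 1) := by
    rw [hcast, hmc]
    have hd : (0 : ℝ) < ((m' : ℝ) + 1) + 2 * n + 1 := by positivity
    rw [← mul_div_assoc, div_le_iff₀ hd]
    nlinarith
  have hηb'' : ((m' + 1 : ℕ) * (n + 1) : ℝ) / ((m' + 1 : ℕ) + 2 * n + 1) < n + 1 := by
    rw [hmc]
    have hd : (0 : ℝ) < ((m' : ℝ) + 1) + 2 * n + 1 := by positivity
    rw [div_lt_iff₀ hd]
    nlinarith
  exact le_trdeg_of_eventually_goodX_ch8 hC hm' hn u v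
    (eventually_goodX u v hm' hn hc hZc hu hv hA hB hηa hηa' hηb hηb' hηb'')

end Assembly



section Corollaries

open DiazThm1

/-- **The Gelfond–Diaz ladder from LNM 1752 Ch. 8 Cor. 1.1 and the zero lemma**:
`trdeg_ℚ ℚ(α^β, …, α^{β^{d-1}}) ≥ [(d+1)/2]` (`diaz_1989`), through `Diaz1989_thm1_of_ch8` and the
tree's `diaz_1989_of_thm1`. [cite: Diaz1989, Corollaire 2, p. 3]
[cite: NesterenkoPhilippon2001, Ch. 14 Corollary 2.8 (p. 248)] -/
theorem diaz_1989_of_ch8 (hC : NesterenkoPhilippon2001_ch8_cor_1_1) (hZ : Diaz1989_zeroLemma) :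
    diaz_1989 :=
  diaz_1989_of_thm1 (Diaz1989_thm1_of_ch8 hC hZ)

/-- LNM 1752, Ch. 14, Thm 2.7, clause `t₁` (under (T.H.)) from Ch. 8 Cor. 1.1 and the zero lemma.
[cite: NesterenkoPhilippon2001, Ch. 14 Thm 2.7 (t₁), p. 248] -/
theorem Diaz1989_gridX_of_ch8 (hC : NesterenkoPhilippon2001_ch8_cor_1_1) (hZ : Diaz1989_zeroLemma) :
    Diaz1989_gridX :=
  Diaz1989_gridX_of_thm1 (Diaz1989_thm1_of_ch8 hC hZ)

/-- Diaz 1989, Corollaire 1 (the ladder for an arbitrary base `a = e^l`) from Ch. 8 Cor. 1.1 and the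
zero lemma. [cite: Diaz1989, Corollaire 1, p. 3] -/
theorem Diaz1989_cor1_of_ch8 (hC : NesterenkoPhilippon2001_ch8_cor_1_1) (hZ : Diaz1989_zeroLemma) :
    Diaz1989_cor1 :=
  Diaz1989_cor1_of_thm1 (Diaz1989_thm1_of_ch8 hC hZ)

/-- **Diaz 1989, Théorème 1, from LNM 1752 Ch. 8 Cor. 1.1 and Philippon's zero estimate on
`𝔾ₐ × 𝔾ₘⁿ`** (the zero lemma being `Diaz1989_zeroLemma_of_P1n`). This is the new trust base of
`Diaz1989_thm1`. [cite: Diaz1989, Théorème 1, pp. 1–2] -/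
theorem Diaz1989_thm1_of_ch8_P1n (hC : NesterenkoPhilippon2001_ch8_cor_1_1)
    (hZ : Philippon1986_GaGm_P1n) : Diaz1989_thm1 :=
  Diaz1989_thm1_of_ch8 hC (Diaz1989_zeroLemma_of_P1n hZ)

/-- `diaz_1989` from LNM 1752 Ch. 8 Cor. 1.1 and Philippon's zero estimate.
[cite: Diaz1989, Corollaire 2, p. 3] -/
theorem diaz_1989_of_ch8_P1n (hC : NesterenkoPhilippon2001_ch8_cor_1_1)
    (hZ : Philippon1986_GaGm_P1n) : diaz_1989 :=
  diaz_1989_of_thm1 (Diaz1989_thm1_of_ch8_P1n hC hZ)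

/-- `Diaz1989_gridX` (LNM 1752 Ch. 14 Thm 2.7, clause `t₁`) from LNM 1752 Ch. 8 Cor. 1.1 and
Philippon's zero estimate. [cite: NesterenkoPhilippon2001, Ch. 14 Thm 2.7 (t₁), p. 248] -/
theorem Diaz1989_gridX_of_ch8_P1n (hC : NesterenkoPhilippon2001_ch8_cor_1_1)
    (hZ : Philippon1986_GaGm_P1n) : Diaz1989_gridX :=
  Diaz1989_gridX_of_thm1 (Diaz1989_thm1_of_ch8_P1n hC hZ)

/-- `Diaz1989_cor1` from LNM 1752 Ch. 8 Cor. 1.1 and Philippon's zero estimate.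
[cite: Diaz1989, Corollaire 1, p. 3] -/
theorem Diaz1989_cor1_of_ch8_P1n (hC : NesterenkoPhilippon2001_ch8_cor_1_1)
    (hZ : Philippon1986_GaGm_P1n) : Diaz1989_cor1 :=
  Diaz1989_cor1_of_thm1 (Diaz1989_thm1_of_ch8_P1n hC hZ)

end Corollaries

end Literature.NumberTheory.Transcendental

end
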